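import Literature.NumberTheory.LFunctions.KMVDiagOnlyBeyondDiagonalRung
import Literature.NumberTheory.LFunctions.KMVMomentAsymptoticsUniqueness
import HarnessLib

/-!
# Diagonal-only persistence on one window forces the VALUE crux of the family route
(Kowalski–Michel–VanderKam 2000, Thm. 6.1 / §6: uniqueness of the main terms + the envelope at `P = X²`)

Topic `Literature/NumberTheory/LFunctions` (cell landau-siegel, BIRTH (2) `PrimeLevelFamEdge`).
TYPED FROM the tribunal desk probe `tools-ls-desk/probes/FamTUnique.lean` v3 (frontier-trib-ls-1 g5,
sha16 0952a788ddc04481, rc 0; INBOX 2026-08-27T01:52:07Z «liftable by a typer; the desk files no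
proposals»), §«Consequence for the route's logic», proofs verbatim over the tree decls of
`KMVMomentAsymptoticsUniqueness` (uniqueness of `T₁, T₂` on `Δ' ≤ 2`) and
`KMVDiagOnlyBeyondDiagonalRung` (`quarter_lt_envelope'`). PROVED, 0 facts.

WHAT IS PROVED. If the DIAGONAL-ONLY asymptotics persist on some window `(1, Δ₀]`
(`KMV2000.MomentAsymptoticsDiagOnly 1 Δ₀` — the design map's famE-02 «placeholder», i.e. the
existence crux K_A witnessed by `T = 0`; OPEN IN PRINT at a fixed level, print has `Δ < 1`,
[KowalskiMichelVanderKam2000, Prop. 5.1 / §6 p. 19]), then for EVERY window `(1, Δ]` and EVERY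
pair `(T₁, T₂)` consistent with `MomentAsymptotics 1 Δ` the value of the profile `X²` at every
`Δ' ∈ (1, min Δ (min Δ₀ 2))` is the one-piece envelope `Δ'/(2(1+Δ'))`, which exceeds `¼`
(`quarter_lt_envelope'`): `beatsQuarter_of_diagOnly` (the route's crux `BeyondDiagonalBeatsQuarter`
in its `(1, b)` shape, Route.md § 2) and `beatsQuarter_ab_of_diagOnly` (an `(a, b)` shape, `a = 1`).
Mechanism: by `T₁/T₂_eq_of_momentAsymptotics_of_le_two` every MA-consistent `T` VANISHES at
`(Δ', X², 1)` for `Δ' ≤ 2` once one MA-consistent pair is `0` there. Contrast the tree's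
`KMV2000.beyondDiagonalBeatsQuarter_of_diagOnly` (the `T = 0` INSTANCE only; hypothesis unused).
Reading (desk): K_B is not derivable from K_A as typed (`∃ T`), but IS derivable from K_A's
diagonal-only strengthening — the route's open content beyond the printed facts is «which `T` does
K_A hold with».

WHAT THIS IS NOT: no claim about `MomentAsymptoticsDiagOnly 1 Δ₀` for any `Δ₀ > 1`, about E*-fam,
or about Landau–Siegel zeros. «The programme SEARCHES and TYPES; no claim about Landau–Siegel zeros,
Theorems 1–2 of arXiv:2211.02515 or a repaired Margin232 until a kernel theorem says so.»

## References

* [KowalskiMichelVanderKam2000] E. Kowalski, P. Michel, J. VanderKam, J. reine angew. Math. 526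
  (2000) 1–34: Thm. 6.1 (32), §6 p. 19, Prop. 5.1 (range `Δ < 1`).
  [held: paper:doi-10-1515-crll-2000-074 p0019–p0020]
-/

noncomputable section

namespace Literature.NumberTheory.LFunctions.KMV2000

open Polynomial

/-- **K_B (Route.md § 2 shape, initial segment `(1, b)`) from diagonal-only persistence on one
window.** [cite: KowalskiMichelVanderKam2000, Thm. 6.1 (32); §6 p. 19] -/
theorem beatsQuarter_of_diagOnly {Δ₀ : ℝ} (hΔ₀ : 1 < Δ₀) (hD : MomentAsymptoticsDiagOnly 1 Δ₀) :
    ∀ Δ : ℝ, 1 < Δ → ∀ T₁ T₂ : ℝ → ℝ[X] → ℝ[X] → ℝ, MomentAsymptotics 1 Δ T₁ T₂ →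
      ∃ b : ℝ, 1 < b ∧ b ≤ Δ ∧ ∃ P : ℝ[X], Admissible P ∧
        ∀ Δ' : ℝ, 1 < Δ' → Δ' < b →
          1 / 4 < (linForm Δ' P 1 + T₁ Δ' P 1) ^ 2 /
            (2 * (secondMomentForm Δ' P 1 + T₂ Δ' P 1)) := by
  intro Δ hΔ T₁ T₂ hMA
  refine ⟨min Δ (min Δ₀ 2), lt_min hΔ (lt_min hΔ₀ (by norm_num)), min_le_left _ _, X ^ 2,
    admissible_X_sq, fun Δ' h1 h2 ↦ ?_⟩
  have hΔ'Δ : Δ' ≤ Δ := h2.le.trans (min_le_left _ _)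
  have hΔ'Δ₀ : Δ' ≤ Δ₀ := h2.le.trans ((min_le_right _ _).trans (min_le_left _ _))
  have hΔ'2 : Δ' ≤ 2 := h2.le.trans ((min_le_right _ _).trans (min_le_right _ _))
  -- both asymptotics on the common window `(1, Δ']`
  have hT : MomentAsymptotics 1 Δ' T₁ T₂ :=
    fun P Q hP hQ Δ'' h1'' h2'' ↦ hMA P Q hP hQ Δ'' h1'' (h2''.trans hΔ'Δ)
  have h0 : MomentAsymptotics 1 Δ' (fun _ _ _ ↦ 0) (fun _ _ _ ↦ 0) :=
    fun P Q hP hQ Δ'' h1'' h2'' ↦ hD P Q hP hQ Δ'' h1'' (h2''.trans hΔ'Δ₀)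
  have hQ1 : IsEvenOrOdd (1 : ℝ[X]) := Or.inl fun x ↦ by simp
  have e1 : T₁ Δ' (X ^ 2) 1 = 0 :=
    T₁_eq_of_momentAsymptotics_of_le_two hT h0 admissible_X_sq hQ1 h1 le_rfl (by linarith) hΔ'2
  have e2 : T₂ Δ' (X ^ 2) 1 = 0 :=
    T₂_eq_of_momentAsymptotics_of_le_two hT h0 admissible_X_sq hQ1 h1 le_rfl (by linarith) hΔ'2
  rw [e1, e2, add_zero, add_zero]
  have h := ratio_one_X_sq (Δ := Δ') (by linarith)
  unfold ratio at h
  rw [h]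
  exact quarter_lt_envelope' h1

/-- The same in an `(a, b)` shape (`1 ≤ a < b ≤ Δ`; take `a = 1`).
[cite: KowalskiMichelVanderKam2000, Thm. 6.1 (32); §6 p. 19] -/
theorem beatsQuarter_ab_of_diagOnly {Δ₀ : ℝ} (hΔ₀ : 1 < Δ₀) (hD : MomentAsymptoticsDiagOnly 1 Δ₀) :
    ∀ Δ : ℝ, 1 < Δ → ∀ T₁ T₂ : ℝ → ℝ[X] → ℝ[X] → ℝ, MomentAsymptotics 1 Δ T₁ T₂ →
      ∃ a b : ℝ, 1 ≤ a ∧ a < b ∧ b ≤ Δ ∧ ∃ P : ℝ[X], Admissible P ∧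
        ∀ Δ' : ℝ, a < Δ' → Δ' < b →
          1 / 4 < (linForm Δ' P 1 + T₁ Δ' P 1) ^ 2 /
            (2 * (secondMomentForm Δ' P 1 + T₂ Δ' P 1)) := by
  intro Δ hΔ T₁ T₂ hMA
  obtain ⟨b, hb1, hbΔ, P, hP, hval⟩ := beatsQuarter_of_diagOnly hΔ₀ hD Δ hΔ T₁ T₂ hMA
  exact ⟨1, b, le_rfl, hb1, hbΔ, P, hP, hval⟩

end Literature.NumberTheory.LFunctions.KMV2000
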